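import Mathlib.Analysis.Calculus.ContDiff.Basic
import Mathlib.Analysis.Calculus.FDeriv.Add
import Mathlib.Analysis.Calculus.FDeriv.Comp
import Mathlib.Analysis.Complex.Basic
import Mathlib.Topology.MetricSpace.ProperSpace
import Mathlib.Topology.Order.Compact
import Summits.SmoothPoincare4.SmoothPoincare4.Theorems.SullivanDualTameOrBrodyR4StubZalcman

/-!
# Flat Zalcman–Brody rescaling in a real normed space

Crux `WitnessCharge` (item stmt-SmoothPoincare4-7824, route route-SmoothPoincare4-SullivanDual),
line `Sketch`, stub `helper_flatZalcman` ((P5)(B): when the gradients of pencil members blow up,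
Zalcman–Brody rescaling produces a non-constant entire curve in a compact piece; after a Whitney
embedding the rescaling step is the flat lemma below, for maps into an arbitrary real normed
space `E`).

The elementary **Zalcman–Brody rescaling** of one `C¹` map `f : ℂ → E` with `f(D̄) ⊆ K` and
`df(0) ≠ 0` (L. Zalcman, *A heuristic principle in complex function theory*, Amer. Math. Monthly
82 (1975); R. Brody, *Compact manifolds and hyperbolicity*, Trans. AMS 235 (1978)).  Maximise the
weighted derivative `φ(ξ) = (1 - ‖ξ‖) ‖df(ξ)‖` over the closed unit disc (compact since `ℂ` is
proper, and `φ` is continuous because `f` is `C¹`), say at `ξ₀`; put `a := 1 - ‖ξ₀‖`,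
`D := ‖df(ξ₀)‖`, `M := a D ≥ φ(0) = ‖df(0)‖ > 0` (so `a > 0`, i.e. `‖ξ₀‖ < 1`, and `D > 0`),
`ρ := D⁻¹ > 0` and `g(ζ) := f(ξ₀ + ρ ζ)`.  By the chain rule `dg(ζ) = ρ • df(ξ₀ + ρ ζ)`, hence
`‖dg(0)‖ = ρ D = 1`.  For `‖ζ‖ ≤ M / 2` the point `ξ₀ + ρ ζ` has norm `≤ ‖ξ₀‖ + a / 2 ≤ 1`, so
`g(ζ) ∈ K`, and `1 - ‖ξ₀ + ρ ζ‖ ≥ a / 2`, whence maximality of `φ` at `ξ₀` gives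
`‖df(ξ₀ + ρ ζ)‖ ≤ 2 D`, i.e. `‖dg(ζ)‖ ≤ 2`.

Uses Mathlib (`IsCompact.exists_isMaxOn`, `isCompact_closedBall`, the chain rule) and the generic
affine-reparametrisation lemmas `Zalcman.norm_fderiv_comp_affine`
(`‖d(f(ξ + ρ ·))(ζ)‖ = ρ ‖df(ξ + ρ ζ)‖` for `ρ ≥ 0`) and `Zalcman.norm_affine_le` of the sibling
file `Summits/SmoothPoincare4/SmoothPoincare4/Theorems/SullivanDualTameOrBrodyR4StubZalcman.lean`
(namespace `Summit.SmoothPoincare4.SmoothPoincare4.Cruxes.TameOrBrodyR4.Sketch`), which proves the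
same rescaling for `E = ℝ⁴` and `C^∞` flat-`J`-holomorphic maps.
-/

noncomputable section

set_option linter.dupNamespace false

open Set Filter Topology Metric
open Summit.SmoothPoincare4.SmoothPoincare4.Cruxes.TameOrBrodyR4.Sketch

namespace Summit.SmoothPoincare4.SmoothPoincare4.Theorems.WitnessCharge.PencilIncompleteness

/-- **Zalcman–Brody rescaling in a real normed space.** A `C¹` map `f : ℂ → E` into a real
normed space, mapping the closed unit disc into `K` and with `df(0) ≠ 0`, admits a centre `ξ₀`
with `‖ξ₀‖ < 1`, a scale `ρ > 0` and a radius parameter `M ≥ ‖df(0)‖` such that the affine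
reparametrisation `g = f(ξ₀ + ρ ·)` is normalised by `‖dg(0)‖ = 1` and satisfies `g(ζ) ∈ K` and
`‖dg(ζ)‖ ≤ 2` on the disc `‖ζ‖ ≤ M / 2`.  Here `ξ₀` maximises `φ(ξ) = (1 - ‖ξ‖) ‖df(ξ)‖` over
the closed unit disc, `M = φ(ξ₀)` and `ρ = ‖df(ξ₀)‖⁻¹` (Zalcman 1975; Brody 1978). -/
theorem helper_flatZalcman :
    ∀ {E : Type} [NormedAddCommGroup E] [NormedSpace ℝ E] (K : Set E) (f : ℂ → E),
      ContDiff ℝ 1 f → (∀ z : ℂ, ‖z‖ ≤ 1 → f z ∈ K) → fderiv ℝ f 0 ≠ 0 →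
      ∃ (ξ₀ : ℂ) (ρ M : ℝ), 0 < ρ ∧ ‖ξ₀‖ < 1 ∧ ‖fderiv ℝ f 0‖ ≤ M ∧
        (∀ ζ : ℂ, ‖ζ‖ ≤ M / 2 → f (ξ₀ + ρ • ζ) ∈ K) ∧
        ‖fderiv ℝ (fun ζ : ℂ => f (ξ₀ + ρ • ζ)) 0‖ = 1 ∧
        (∀ ζ : ℂ, ‖ζ‖ ≤ M / 2 → ‖fderiv ℝ (fun ζ : ℂ => f (ξ₀ + ρ • ζ)) ζ‖ ≤ 2) := by
  intro E _ _ K f hf hfK h0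
  have hdiff : Differentiable ℝ f := hf.differentiable one_ne_zero
  -- the weighted derivative `φ ξ = (1 - ‖ξ‖) ‖df ξ‖` is continuous; maximise it on the closed disc
  have hφc : Continuous fun ξ : ℂ => (1 - ‖ξ‖) * ‖fderiv ℝ f ξ‖ :=
    (continuous_const.sub continuous_norm).mul (hf.continuous_fderiv one_ne_zero).norm
  obtain ⟨ξ₀, hξ₀, hmax⟩ := (isCompact_closedBall (0 : ℂ) 1).exists_isMaxOn
    ⟨0, mem_closedBall_self zero_le_one⟩ hφc.continuousOn
  rw [isMaxOn_iff] at hmax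
  rw [mem_closedBall_zero_iff] at hξ₀
  -- abbreviations: `a = 1 - ‖ξ₀‖`, `D = ‖df ξ₀‖`, `M = a * D`, `ρ = D⁻¹`
  obtain ⟨a, ha⟩ : ∃ a : ℝ, a = 1 - ‖ξ₀‖ := ⟨_, rfl⟩
  obtain ⟨D, hD⟩ : ∃ D : ℝ, D = ‖fderiv ℝ f ξ₀‖ := ⟨_, rfl⟩
  have hmax' : ∀ w : ℂ, ‖w‖ ≤ 1 → (1 - ‖w‖) * ‖fderiv ℝ f w‖ ≤ a * D := fun w hw => by
    rw [ha, hD]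
    exact hmax w (mem_closedBall_zero_iff.mpr hw)
  have hM0 : ‖fderiv ℝ f 0‖ ≤ a * D := by
    have := hmax' 0 (by simp)
    simpa using this
  have hMpos : 0 < a * D := (norm_pos_iff.mpr h0).trans_le hM0
  have ha0 : 0 ≤ a := by rw [ha]; linarith
  have hD0 : 0 ≤ D := by rw [hD]; exact norm_nonneg _
  have hapos : 0 < a := lt_of_le_of_ne ha0 fun h => by
    rw [← h, zero_mul] at hMpos
    exact lt_irrefl 0 hMpos
  have hDpos : 0 < D := lt_of_le_of_ne hD0 fun h => by
    rw [← h, mul_zero] at hMpos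
    exact lt_irrefl 0 hMpos
  have hξ₀1 : ‖ξ₀‖ < 1 := by
    rw [ha] at hapos
    linarith
  obtain ⟨ρ, hρ⟩ : ∃ ρ : ℝ, ρ = D⁻¹ := ⟨_, rfl⟩
  have hρpos : 0 < ρ := by rw [hρ]; exact inv_pos.mpr hDpos
  have hρD : ρ * D = 1 := by rw [hρ]; exact inv_mul_cancel₀ hDpos.ne'
  have hρM : ρ * (a * D / 2) = a / 2 := by
    rw [hρ]
    field_simp
  -- the disc `‖ζ‖ ≤ M / 2` is mapped into the disc `‖ξ‖ ≤ ‖ξ₀‖ + a / 2 ≤ 1`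
  have hw : ∀ ζ : ℂ, ‖ζ‖ ≤ a * D / 2 → ‖ξ₀ + ρ • ζ‖ ≤ ‖ξ₀‖ + a / 2 := fun ζ hζ => by
    calc ‖ξ₀ + ρ • ζ‖ ≤ ‖ξ₀‖ + ρ * ‖ζ‖ := Zalcman.norm_affine_le ξ₀ ζ hρpos.le
      _ ≤ ‖ξ₀‖ + ρ * (a * D / 2) := by gcongr
      _ = ‖ξ₀‖ + a / 2 := by rw [hρM]
  have hw1 : ∀ ζ : ℂ, ‖ζ‖ ≤ a * D / 2 → ‖ξ₀ + ρ • ζ‖ ≤ 1 := fun ζ hζ => by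
    have := hw ζ hζ
    linarith
  refine ⟨ξ₀, ρ, a * D, hρpos, hξ₀1, hM0, fun ζ hζ => hfK _ (hw1 ζ hζ), ?_, fun ζ hζ => ?_⟩
  · -- `‖dg(0)‖ = ρ ‖df(ξ₀)‖ = 1`
    rw [Zalcman.norm_fderiv_comp_affine hdiff ξ₀ hρpos.le, smul_zero, add_zero, ← hD, hρD]
  · -- `‖dg(ζ)‖ = ρ ‖df(ξ₀ + ρ ζ)‖ ≤ ρ · 2 D = 2` by maximality of `φ` at `ξ₀`
    rw [Zalcman.norm_fderiv_comp_affine hdiff ξ₀ hρpos.le]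
    have h1 := hmax' _ (hw1 ζ hζ)
    have h2 : a / 2 ≤ 1 - ‖ξ₀ + ρ • ζ‖ := by
      have := hw ζ hζ
      linarith
    have h3 : a / 2 * ‖fderiv ℝ f (ξ₀ + ρ • ζ)‖ ≤ a / 2 * (2 * D) :=
      calc a / 2 * ‖fderiv ℝ f (ξ₀ + ρ • ζ)‖
          ≤ (1 - ‖ξ₀ + ρ • ζ‖) * ‖fderiv ℝ f (ξ₀ + ρ • ζ)‖ :=
            mul_le_mul_of_nonneg_right h2 (norm_nonneg _)
        _ ≤ a * D := h1
        _ = a / 2 * (2 * D) := by ring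
    have h4 : ‖fderiv ℝ f (ξ₀ + ρ • ζ)‖ ≤ 2 * D := le_of_mul_le_mul_left h3 (half_pos hapos)
    calc ρ * ‖fderiv ℝ f (ξ₀ + ρ • ζ)‖ ≤ ρ * (2 * D) := mul_le_mul_of_nonneg_left h4 hρpos.le
      _ = 2 := by rw [mul_left_comm, hρD, mul_one]

end Summit.SmoothPoincare4.SmoothPoincare4.Theorems.WitnessCharge.PencilIncompleteness
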